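import Summits.QuantumFields.BalabanUV.T4Continuum.Support.NE7PairGlueStep
import HarnessLib

/-!
# NE7PairColourStep — ONE COLOUR STEP OF THE GLUING INDUCTION (F320): the running gauge `u`, good on the cores of the processed parities `C`, is glued
# with the patch `v(x) = g_{ζ_c(x)}(x)` (the chart of the nearest parity-`c` block) along the core profile; the five invariants (unitary, pinned at all block
# corners, `2NM`-periodic, SITE-closeness `τ` to every chart whose cube contains the site, BOND pair defect `η` between covered sites) propagate from `C` to
# `C ∪ {c}` with `τ ↦ 4τ + τ_cc` and `η ↦ 7η_ch + 6η + 16τ∕M`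

Cell `pub-balaban`, sub-cell t4, lineage `b2b-balaban-t4-ne7-p1` (CRUX PROVER NE7 #1 = OWNER of row NE7), gen 94; memo
`t4/b2b-balaban-t4-ne7-p1-g94/PAIR-REP-ROAD.md` §6.  File 6 of the road to the PAIR RESIDUAL SUP-REPRESENTATIVE; over F315 `NE7PairGlueStep` (the two-party step and
its letters).  All geometric objects are HYPOTHESES here (chart family `g` with its cube letter `η_ch`, pinning, `N`-equivariance and site-closeness `τ_cc` — F317∕F318;
core profile `φ` and parity-block map `Z` — F319∕F319b), so the file is pure bookkeeping of the five invariants through one glue step.  The step glues with the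
REGULARISED weight `φ̃ = φ_c` where `φ_c = 1` or `‖v − u‖ ≤ 1∕4`, `φ̃ = 0` elsewhere (so the glued gauge is unitary even at not-yet-covered sites, where the running
gauge is arbitrary); at covered and new-core sites `φ̃ = φ_c`.
WHAT ([folklore]; 0 def, 0 sorry; any C⋆-algebra, any `d`, `M ≥ 2`): `colour_step` — see the statement; the covered set is `{x : x ∈ core ζ, ζ ≡ c′ (mod 2), c′ ∈ C}`
written out, `C : Set (Site d)` arbitrary.
HONEST FRAMING: bookkeeping; nothing of Bałaban's asserted; hleaves NOT discharged; NE7 NOT PROVED; spine 0∕9; finite T⁴ rung (B)+1 — NOT infinite volume, NOT mass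
gap, NOT `BetaPertH`, NOT Clay.  Axioms ⊆ {propext, Classical.choice, Quot.sound}.
-/

set_option autoImplicit false

open NormedSpace
open scoped BigOperators

namespace Summit.QuantumFields.BalabanUV.T4Continuum.NE7PairColourStep

open Literature.MathematicalPhysics.QuantumFieldTheory.Balaban1983to89
open MatrixLog B7Prop1Explicit B7Prop2Explicit UnitaryRootInterpolation UnitaryGeodesic NE7PairGlueStep

noncomputable section

variable {𝔸 : Type*} [CStarAlgebra 𝔸] [Nontrivial 𝔸] {d : ℕ}

/-- The half-open window `[−M, M)` lies in the closed cube. [folklore] -/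
theorem cube_of_window {M : ℕ} {ζ x : Site d} (h : ∀ i, -(M : ℤ) ≤ x i - (M : ℤ) * ζ i ∧ x i - (M : ℤ) * ζ i < (M : ℤ)) :
    ∀ i, |x i - (M : ℤ) * ζ i| ≤ (M : ℤ) := fun i => by
  rw [abs_le]; constructor <;> linarith [(h i).1, (h i).2]

/-- A core site lies in the half-open window of its block. [folklore] -/
theorem window_of_core_self {M : ℕ} {ζ x : Site d}
    (hx : ∀ i, -(M : ℤ) ≤ 2 * (x i - (M : ℤ) * ζ i) ∧ 2 * (x i - (M : ℤ) * ζ i) ≤ (M : ℤ) - 1) :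
    ∀ i, -(M : ℤ) ≤ x i - (M : ℤ) * ζ i ∧ x i - (M : ℤ) * ζ i < (M : ℤ) := fun i => by
  have h := hx i; omega

/-- A core site, and its two neighbours along any bond, lie in the half-open window of the core's block (`M ≥ 2`). [folklore] -/
theorem window_of_core {M : ℕ} (hM : 2 ≤ M) {ζ x : Site d}
    (hx : ∀ i, -(M : ℤ) ≤ 2 * (x i - (M : ℤ) * ζ i) ∧ 2 * (x i - (M : ℤ) * ζ i) ≤ (M : ℤ) - 1) (μ : Fin d) :
    (∀ i, -(M : ℤ) ≤ x i - (M : ℤ) * ζ i ∧ x i - (M : ℤ) * ζ i < (M : ℤ)) ∧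
    (∀ i, -(M : ℤ) ≤ (x + e μ) i - (M : ℤ) * ζ i ∧ (x + e μ) i - (M : ℤ) * ζ i < (M : ℤ)) ∧
    (∀ i, -(M : ℤ) ≤ (x - e μ) i - (M : ℤ) * ζ i ∧ (x - e μ) i - (M : ℤ) * ζ i < (M : ℤ)) := by
  have hM' : (2 : ℤ) ≤ M := by exact_mod_cast hM
  refine ⟨fun i => ?_, fun i => ?_, fun i => ?_⟩ <;>
  · have h := hx i
    try simp only [Pi.add_apply, Pi.sub_apply, e_apply]
    try split_ifs
    all_goals omega

/-- A support site (sharp window `−3M < 4t < 3M − 2`), and its two neighbours along any bond, lie in the half-open window (`M ≥ 2`). [folklore] -/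
theorem window_of_support {M : ℕ} (hM : 2 ≤ M) {ζ x : Site d}
    (hx : ∀ i, -(3 * (M : ℤ)) < 4 * (x i - (M : ℤ) * ζ i) ∧ 4 * (x i - (M : ℤ) * ζ i) < 3 * (M : ℤ) - 2) (μ : Fin d) :
    (∀ i, -(M : ℤ) ≤ x i - (M : ℤ) * ζ i ∧ x i - (M : ℤ) * ζ i < (M : ℤ)) ∧
    (∀ i, -(M : ℤ) ≤ (x + e μ) i - (M : ℤ) * ζ i ∧ (x + e μ) i - (M : ℤ) * ζ i < (M : ℤ)) ∧
    (∀ i, -(M : ℤ) ≤ (x - e μ) i - (M : ℤ) * ζ i ∧ (x - e μ) i - (M : ℤ) * ζ i < (M : ℤ)) := by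
  have hM' : (2 : ℤ) ≤ M := by exact_mod_cast hM
  refine ⟨fun i => ?_, fun i => ?_, fun i => ?_⟩ <;>
  · have h := hx i
    try simp only [Pi.add_apply, Pi.sub_apply, e_apply]
    try split_ifs
    all_goals omega

/-- **ADJACENT CORES OF THE SAME PARITY COINCIDE**: if `x ∈ core ζ`, `x + e_μ ∈ core ζ′` and `ζ ≡ ζ′ ≡ c (mod 2)` then `ζ′ = ζ` (`M ≥ 1`). [folklore] -/
theorem core_step_parity {M : ℕ} (hM : 1 ≤ M) {ζ ζ' x : Site d} {μ : Fin d} {c w w' : Site d} (hζ : ζ = c + (2 : ℤ) • w) (hζ' : ζ' = c + (2 : ℤ) • w')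
    (hx : ∀ i, -(M : ℤ) ≤ 2 * (x i - (M : ℤ) * ζ i) ∧ 2 * (x i - (M : ℤ) * ζ i) ≤ (M : ℤ) - 1)
    (hy : ∀ i, -(M : ℤ) ≤ 2 * ((x + e μ) i - (M : ℤ) * ζ' i) ∧ 2 * ((x + e μ) i - (M : ℤ) * ζ' i) ≤ (M : ℤ) - 1) : ζ' = ζ := by
  funext i
  have h1 := hx i; have h2 := hy i
  have hM' : (1 : ℤ) ≤ M := by exact_mod_cast hM
  rw [hζ, hζ'] at *
  simp only [Pi.add_apply, Pi.smul_apply, smul_eq_mul, e_apply] at h1 h2 ⊢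
  have hlt : 2 * (M : ℤ) * (w' i - w i) < 2 * M := by split_ifs at h2 <;> nlinarith
  have hgt : -(2 * (M : ℤ)) < 2 * (M : ℤ) * (w' i - w i) := by split_ifs at h2 <;> nlinarith
  have h3 : w' i - w i < 1 := by by_contra h; push Not at h; nlinarith
  have h4 : -1 < w' i - w i := by by_contra h; push Not at h; nlinarith
  have : w' i = w i := by omega
  rw [this]

/-- **THE COLOUR STEP** of the gluing induction (see the file header). [folklore] -/
theorem colour_step {Us U' : Site d → Fin d → 𝔸ˣ} (hUs : ∀ x μ, Us x μ ∈ unitaryUnits 𝔸) (hU' : ∀ x μ, U' x μ ∈ unitaryUnits 𝔸)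
    {M N : ℕ} (hM : 2 ≤ M)
    -- the pinned chart family with its cube letter, equivariance and site-closeness
    {g : Site d → Site d → 𝔸ˣ} (hgU : ∀ ζ x, g ζ x ∈ unitaryUnits 𝔸) (hpin : ∀ ζ, g ζ ((M : ℤ) • ζ) = 1) {ηch : ℝ} (hηch : 0 ≤ ηch)
    (herr : ∀ (ζ y : Site d) (κ : Fin d), (∀ i, |y i - (M : ℤ) * ζ i| ≤ (M : ℤ)) →
      ‖(((Us y κ)⁻¹ * gaugeAct (g ζ) U' y κ : 𝔸ˣ) : 𝔸) - 1‖ ≤ ηch)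
    (hgeq : ∀ (ζ x : Site d) (i : Fin d), g (ζ + (N : ℤ) • e i) (x + ((N * M : ℕ) : ℤ) • e i) = g ζ x)
    {τcc : ℝ}
    (hτcc : ∀ (ζ ζ' x : Site d), (∀ i, |x i - (M : ℤ) * ζ i| ≤ (M : ℤ)) → (∀ i, |x i - (M : ℤ) * ζ' i| ≤ (M : ℤ)) →
      ‖((g ζ x : 𝔸ˣ) : 𝔸) - ((g ζ' x : 𝔸ˣ) : 𝔸)‖ ≤ τcc)
    -- the core profile (sharp form) and the parity-block map of the colour `c`
    {φ : Site d → Site d → ℝ} (hφ01 : ∀ ζ x, 0 ≤ φ ζ x ∧ φ ζ x ≤ 1)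
    (hφcore : ∀ ζ x, (∀ i, -(M : ℤ) ≤ 2 * (x i - (M : ℤ) * ζ i) ∧ 2 * (x i - (M : ℤ) * ζ i) ≤ (M : ℤ) - 1) → φ ζ x = 1)
    (hφsupp : ∀ ζ x, 0 < φ ζ x → ∀ i, -(3 * (M : ℤ)) < 4 * (x i - (M : ℤ) * ζ i) ∧ 4 * (x i - (M : ℤ) * ζ i) < 3 * (M : ℤ) - 2)
    (hφlip : ∀ (ζ x : Site d) (μ : Fin d), |φ ζ x - φ ζ (x + e μ)| ≤ 4 / (M : ℝ))
    (hφcov : ∀ ζ w x, φ (ζ + w) (x + (M : ℤ) • w) = φ ζ x)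
    (c : Site d) {Z : Site d → Site d} (hZpar : ∀ x, ∃ w : Site d, Z x = c + (2 : ℤ) • w)
    (hZcube : ∀ x i, |x i - (M : ℤ) * Z x i| ≤ (M : ℤ))
    (hZuniq : ∀ (x ζ w : Site d), ζ = c + (2 : ℤ) • w → (∀ i, -(M : ℤ) ≤ x i - (M : ℤ) * ζ i ∧ x i - (M : ℤ) * ζ i < (M : ℤ)) → Z x = ζ)
    (hZper : ∀ (x : Site d) (i : Fin d), Z (x + ((2 * N * M : ℕ) : ℤ) • e i) = Z x + ((2 * N : ℕ) : ℤ) • e i)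
    -- the processed parities and the running gauge with its five invariants
    (C : Set (Site d)) {u : Site d → 𝔸ˣ} {τs ηs : ℝ} (hτs0 : 0 ≤ τs) (hηs0 : 0 ≤ ηs) (hτs : τs ≤ 1 / 4)
    (huU : ∀ x, u x ∈ unitaryUnits 𝔸) (hupin : ∀ ζ : Site d, u ((M : ℤ) • ζ) = 1)
    (huper : ∀ (x : Site d) (i : Fin d), u (x + ((2 * N * M : ℕ) : ℤ) • e i) = u x)
    (husite : ∀ x, (∃ c' ∈ C, ∃ ζ w : Site d, ζ = c' + (2 : ℤ) • w ∧
        ∀ i, -(M : ℤ) ≤ 2 * (x i - (M : ℤ) * ζ i) ∧ 2 * (x i - (M : ℤ) * ζ i) ≤ (M : ℤ) - 1) →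
      ∀ ζ : Site d, (∀ i, |x i - (M : ℤ) * ζ i| ≤ (M : ℤ)) → ‖((u x : 𝔸ˣ) : 𝔸) - ((g ζ x : 𝔸ˣ) : 𝔸)‖ ≤ τs)
    (hubond : ∀ (x : Site d) (μ : Fin d),
      (∃ c' ∈ C, ∃ ζ w : Site d, ζ = c' + (2 : ℤ) • w ∧ ∀ i, -(M : ℤ) ≤ 2 * (x i - (M : ℤ) * ζ i) ∧ 2 * (x i - (M : ℤ) * ζ i) ≤ (M : ℤ) - 1) →
      (∃ c' ∈ C, ∃ ζ w : Site d, ζ = c' + (2 : ℤ) • w ∧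
        ∀ i, -(M : ℤ) ≤ 2 * ((x + e μ) i - (M : ℤ) * ζ i) ∧ 2 * ((x + e μ) i - (M : ℤ) * ζ i) ≤ (M : ℤ) - 1) →
      ‖(((Us x μ)⁻¹ * gaugeAct u U' x μ : 𝔸ˣ) : 𝔸) - 1‖ ≤ ηs) :
    ∃ u' : Site d → 𝔸ˣ,
      (∀ x, u' x ∈ unitaryUnits 𝔸) ∧ (∀ ζ : Site d, u' ((M : ℤ) • ζ) = 1) ∧
      (∀ (x : Site d) (i : Fin d), u' (x + ((2 * N * M : ℕ) : ℤ) • e i) = u' x) ∧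
      (∀ x, (∃ c' ∈ C ∪ {c}, ∃ ζ w : Site d, ζ = c' + (2 : ℤ) • w ∧
          ∀ i, -(M : ℤ) ≤ 2 * (x i - (M : ℤ) * ζ i) ∧ 2 * (x i - (M : ℤ) * ζ i) ≤ (M : ℤ) - 1) →
        ∀ ζ : Site d, (∀ i, |x i - (M : ℤ) * ζ i| ≤ (M : ℤ)) → ‖((u' x : 𝔸ˣ) : 𝔸) - ((g ζ x : 𝔸ˣ) : 𝔸)‖ ≤ 4 * τs + τcc) ∧
      (∀ (x : Site d) (μ : Fin d),
        (∃ c' ∈ C ∪ {c}, ∃ ζ w : Site d, ζ = c' + (2 : ℤ) • w ∧ ∀ i, -(M : ℤ) ≤ 2 * (x i - (M : ℤ) * ζ i) ∧ 2 * (x i - (M : ℤ) * ζ i) ≤ (M : ℤ) - 1) →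
        (∃ c' ∈ C ∪ {c}, ∃ ζ w : Site d, ζ = c' + (2 : ℤ) • w ∧
          ∀ i, -(M : ℤ) ≤ 2 * ((x + e μ) i - (M : ℤ) * ζ i) ∧ 2 * ((x + e μ) i - (M : ℤ) * ζ i) ≤ (M : ℤ) - 1) →
        ‖(((Us x μ)⁻¹ * gaugeAct u' U' x μ : 𝔸ˣ) : 𝔸) - 1‖ ≤ 7 * ηch + 6 * ηs + 16 * τs / (M : ℝ)) := by
  classical
  have hM1 : 1 ≤ M := le_trans (by norm_num) hM
  have hM0 : (0 : ℝ) < M := by exact_mod_cast (by omega : 0 < M)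
  -- the patch, its profile, the regularised weight and the glued gauge
  let v : Site d → 𝔸ˣ := fun x => g (Z x) x
  let Φ : Site d → ℝ := fun x => φ (Z x) x
  let φt : Site d → ℝ := fun x => if (Φ x = 1 ∨ ‖((v x : 𝔸ˣ) : 𝔸) - ((u x : 𝔸ˣ) : 𝔸)‖ ≤ 1 / 4) then Φ x else 0
  let w : Site d → 𝔸ˣ := fun x => if φt x ≤ 0 then u x else if 1 ≤ φt x then v x else geo (φt x) (u x) (v x)
  have hvU : ∀ x, v x ∈ unitaryUnits 𝔸 := fun x => hgU _ _
  have hΦ01 : ∀ x, 0 ≤ Φ x ∧ Φ x ≤ 1 := fun x => hφ01 _ _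
  have hφt01 : ∀ x, 0 ≤ φt x ∧ φt x ≤ 1 := by
    intro x; simp only [φt]; split_ifs
    · exact hΦ01 x
    · exact ⟨le_rfl, zero_le_one⟩
  have hw0 : ∀ x, φt x ≤ 0 → w x = u x := fun x h => by simp only [w, if_pos h]
  have hw1 : ∀ x, 1 ≤ φt x → w x = v x := fun x h => by
    have h' : ¬ φt x ≤ 0 := by linarith
    simp only [w, if_neg h', if_pos h]
  have hwm : ∀ x, 0 < φt x → φt x < 1 → w x = geo (φt x) (u x) (v x) := fun x h0 h1 => by
    have h' : ¬ φt x ≤ 0 := by linarith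
    have h'' : ¬ 1 ≤ φt x := by linarith
    simp only [w, if_neg h', if_neg h'']
  -- regularity: where `0 < φ̃ < 1` the two parties are close, so `w` is unitary everywhere
  have hφt_reg : ∀ x, 0 < φt x → (Φ x = 1 ∨ ‖((v x : 𝔸ˣ) : 𝔸) - ((u x : 𝔸ˣ) : 𝔸)‖ ≤ 1 / 4) ∧ φt x = Φ x := by
    intro x h
    by_cases hc : (Φ x = 1 ∨ ‖((v x : 𝔸ˣ) : 𝔸) - ((u x : 𝔸ˣ) : 𝔸)‖ ≤ 1 / 4)
    · exact ⟨hc, by simp only [φt, if_pos hc]⟩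
    · exfalso; simp only [φt, if_neg hc] at h; exact lt_irrefl _ h
  have hwU : ∀ x, w x ∈ unitaryUnits 𝔸 := by
    intro x
    rcases lt_or_ge 0 (φt x) with h0 | h0
    · rcases lt_or_ge (φt x) 1 with h1 | h1
      · obtain ⟨hc, heq⟩ := hφt_reg x h0
        have hτ : ‖((v x : 𝔸ˣ) : 𝔸) - ((u x : 𝔸ˣ) : 𝔸)‖ ≤ 1 / 4 := by
          rcases hc with h | h
          · exfalso; rw [heq, h] at h1; exact lt_irrefl _ h1
          · exact h
        rw [hwm x h0 h1]; exact geo_mem_unitaryUnits (huU x) (hvU x) hτ _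
      · rw [hw1 x h1]; exact hvU x
    · rw [hw0 x h0]; exact huU x
  -- bond values of gauges agreeing at both endpoints agree
  have hcongr : ∀ (a b : Site d → 𝔸ˣ) (z : Site d) (μ : Fin d), a z = b z → a (z + e μ) = b (z + e μ) →
      gaugeAct a U' z μ = gaugeAct b U' z μ := fun a b z μ h1 h2 => by simp only [gaugeAct, h1, h2]
  -- the patch equals the chart `g ζ₀` on a bond both of whose endpoints `Z` sends to `ζ₀`
  have herr_v : ∀ (z : Site d) (μ : Fin d) (ζ₀ : Site d), Z z = ζ₀ → Z (z + e μ) = ζ₀ → (∀ i, |z i - (M : ℤ) * ζ₀ i| ≤ (M : ℤ)) →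
      ‖(((Us z μ)⁻¹ * gaugeAct v U' z μ : 𝔸ˣ) : 𝔸) - 1‖ ≤ ηch := by
    intro z μ ζ₀ h1 h2 hcube
    have : gaugeAct v U' z μ = gaugeAct (g ζ₀) U' z μ := hcongr v (g ζ₀) z μ (by simp only [v, h1]) (by simp only [v, h2])
    rw [this]; exact herr ζ₀ z μ hcube
  -- old-covered sites: the patch is `τs`-close to the running gauge, so the regularised weight is the profile
  have hold : ∀ z : Site d, (∃ c' ∈ C, ∃ ζ w : Site d, ζ = c' + (2 : ℤ) • w ∧
      ∀ i, -(M : ℤ) ≤ 2 * (z i - (M : ℤ) * ζ i) ∧ 2 * (z i - (M : ℤ) * ζ i) ≤ (M : ℤ) - 1) →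
      ‖((v z : 𝔸ˣ) : 𝔸) - ((u z : 𝔸ˣ) : 𝔸)‖ ≤ τs ∧ φt z = Φ z := by
    intro z hz
    have hτ : ‖((v z : 𝔸ˣ) : 𝔸) - ((u z : 𝔸ˣ) : 𝔸)‖ ≤ τs := by
      rw [norm_sub_rev]; exact husite z hz (Z z) (hZcube z)
    refine ⟨hτ, ?_⟩
    have hc : (Φ z = 1 ∨ ‖((v z : 𝔸ˣ) : 𝔸) - ((u z : 𝔸ˣ) : 𝔸)‖ ≤ 1 / 4) := Or.inr (hτ.trans hτs)
    simp only [φt, if_pos hc]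
  -- new-core sites: `Z = ζ₀`, the weight is `1` and the glued gauge IS the chart `g ζ₀`
  have hnew : ∀ (z ζ₀ w₀ : Site d), ζ₀ = c + (2 : ℤ) • w₀ →
      (∀ i, -(M : ℤ) ≤ 2 * (z i - (M : ℤ) * ζ₀ i) ∧ 2 * (z i - (M : ℤ) * ζ₀ i) ≤ (M : ℤ) - 1) →
      Z z = ζ₀ ∧ Φ z = 1 ∧ φt z = 1 ∧ w z = g ζ₀ z := by
    intro z ζ₀ w₀ hζ₀ hcore
    have hZ : Z z = ζ₀ := hZuniq z ζ₀ w₀ hζ₀ (window_of_core_self hcore)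
    have hΦ : Φ z = 1 := by simp only [Φ, hZ]; exact hφcore ζ₀ z hcore
    have hφt : φt z = 1 := by simp only [φt, if_pos (Or.inl hΦ)]; exact hΦ
    refine ⟨hZ, hΦ, hφt, ?_⟩
    rw [hw1 z (by rw [hφt])]
    simp only [v, hZ]
  -- the patch and the weight are `2NM`-periodic
  have hvper : ∀ (x : Site d) (i : Fin d), v (x + ((2 * N * M : ℕ) : ℤ) • e i) = v x := by
    intro x i
    show g (Z (x + ((2 * N * M : ℕ) : ℤ) • e i)) (x + ((2 * N * M : ℕ) : ℤ) • e i) = g (Z x) x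
    rw [hZper x i]
    have h2N : ((2 * N : ℕ) : ℤ) • (e i : Site d) = (N : ℤ) • e i + (N : ℤ) • e i := by rw [← add_smul]; congr 1; push_cast; ring
    have h2NM : ((2 * N * M : ℕ) : ℤ) • (e i : Site d) = ((N * M : ℕ) : ℤ) • e i + ((N * M : ℕ) : ℤ) • e i := by
      rw [← add_smul]; congr 1; push_cast; ring
    rw [h2N, h2NM, ← add_assoc, ← add_assoc, hgeq, hgeq]
  have hΦper : ∀ (x : Site d) (i : Fin d), Φ (x + ((2 * N * M : ℕ) : ℤ) • e i) = Φ x := by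
    intro x i
    show φ (Z (x + ((2 * N * M : ℕ) : ℤ) • e i)) (x + ((2 * N * M : ℕ) : ℤ) • e i) = φ (Z x) x
    rw [hZper x i]
    have : ((2 * N * M : ℕ) : ℤ) • (e i : Site d) = (M : ℤ) • (((2 * N : ℕ) : ℤ) • e i) := by
      rw [smul_smul]; congr 1; push_cast; ring
    rw [this]
    exact hφcov (Z x) _ x
  have hφtper : ∀ (x : Site d) (i : Fin d), φt (x + ((2 * N * M : ℕ) : ℤ) • e i) = φt x := by
    intro x i; simp only [φt, hΦper, hvper, huper]
  refine ⟨w, hwU, fun ζ => ?_, fun x i => glue_shift hw0 hw1 hwm (fun y => hφtper y i) (fun y => huper y i) (fun y => hvper y i) x,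
    fun x hx ζ hζx => ?_, fun x μ hx hy => ?_⟩
  · -- PINNING at every block corner
    by_cases hZ : Z ((M : ℤ) • ζ) = ζ
    · have huv : u ((M : ℤ) • ζ) = v ((M : ℤ) • ζ) := by
        show u ((M : ℤ) • ζ) = g (Z ((M : ℤ) • ζ)) ((M : ℤ) • ζ)
        rw [hZ, hpin, hupin]
      rw [glue_eq_of_eq hw0 hw1 hwm huv, hupin]
    · -- the corner of another parity block is outside the support: weight `0`
      have hΦ0 : Φ ((M : ℤ) • ζ) = 0 := by
        rcases (hΦ01 ((M : ℤ) • ζ)).1.lt_or_eq with hpos | h0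
        · exfalso; apply hZ
          have hs := hφsupp (Z ((M : ℤ) • ζ)) ((M : ℤ) • ζ) hpos
          funext i
          have h := hs i
          simp only [Pi.smul_apply, smul_eq_mul] at h
          have h1 : (M : ℤ) * (ζ i - Z ((M : ℤ) • ζ) i) < M := by nlinarith
          have h2 : -(M : ℤ) < (M : ℤ) * (ζ i - Z ((M : ℤ) • ζ) i) := by nlinarith
          have hM' : (0 : ℤ) < M := by exact_mod_cast (by omega : 0 < M)
          have h3 : ζ i - Z ((M : ℤ) • ζ) i < 1 := by by_contra h; push Not at h; nlinarith
          have h4 : -1 < ζ i - Z ((M : ℤ) • ζ) i := by by_contra h; push Not at h; nlinarith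
          omega
        · exact h0.symm
      have hφt0 : φt ((M : ℤ) • ζ) ≤ 0 := by
        simp only [φt, hΦ0]; split_ifs <;> exact le_rfl
      rw [hw0 _ hφt0, hupin]
  · -- SITE closeness to every chart whose cube contains `x`
    obtain ⟨c', hc', ζ₀, w₀, hζ₀, hcore⟩ := hx
    rcases hc' with hc' | hc'
    · -- old-covered
      have hxold : ∃ c' ∈ C, ∃ ζ w : Site d, ζ = c' + (2 : ℤ) • w ∧
          ∀ i, -(M : ℤ) ≤ 2 * (x i - (M : ℤ) * ζ i) ∧ 2 * (x i - (M : ℤ) * ζ i) ≤ (M : ℤ) - 1 := ⟨c', hc', ζ₀, w₀, hζ₀, hcore⟩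
      obtain ⟨hτ, -⟩ := hold x hxold
      have h1 : ‖((w x : 𝔸ˣ) : 𝔸) - ((v x : 𝔸ˣ) : 𝔸)‖ ≤ 4 * (1 - φt x) * ‖((v x : 𝔸ˣ) : 𝔸) - ((u x : 𝔸ˣ) : 𝔸)‖ :=
        norm_glue_sub_right_le hφt01 hw0 hw1 hwm huU hvU (fun _ => hτ.trans hτs)
      have h2 : ‖((v x : 𝔸ˣ) : 𝔸) - ((g ζ x : 𝔸ˣ) : 𝔸)‖ ≤ τcc := hτcc (Z x) ζ x (hZcube x) hζx
      have h3 : 4 * (1 - φt x) * ‖((v x : 𝔸ˣ) : 𝔸) - ((u x : 𝔸ˣ) : 𝔸)‖ ≤ 4 * τs := by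
        have := (hφt01 x).1
        nlinarith [norm_nonneg (((v x : 𝔸ˣ) : 𝔸) - ((u x : 𝔸ˣ) : 𝔸)), (hφt01 x).2]
      calc ‖((w x : 𝔸ˣ) : 𝔸) - ((g ζ x : 𝔸ˣ) : 𝔸)‖
          = ‖(((w x : 𝔸ˣ) : 𝔸) - ((v x : 𝔸ˣ) : 𝔸)) + (((v x : 𝔸ˣ) : 𝔸) - ((g ζ x : 𝔸ˣ) : 𝔸))‖ := by rw [sub_add_sub_cancel]
        _ ≤ ‖((w x : 𝔸ˣ) : 𝔸) - ((v x : 𝔸ˣ) : 𝔸)‖ + ‖((v x : 𝔸ˣ) : 𝔸) - ((g ζ x : 𝔸ˣ) : 𝔸)‖ := norm_add_le _ _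
        _ ≤ 4 * τs + τcc := by linarith
    · -- new core
      have hc'c : c' = c := hc'
      rw [hc'c] at hζ₀
      obtain ⟨hZ, -, -, hwx⟩ := hnew x ζ₀ w₀ hζ₀ hcore
      rw [hwx]
      have h := hτcc ζ₀ ζ x (cube_of_window (window_of_core_self hcore)) hζx
      linarith
  · -- BOND defect between covered sites
    have hbig : ηch ≤ 7 * ηch + 6 * ηs + 16 * τs / (M : ℝ) := by
      have : 0 ≤ 16 * τs / (M : ℝ) := by positivity
      linarith
    have h16 : 4 * (4 / (M : ℝ)) * τs = 16 * τs / (M : ℝ) := by ring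
    obtain ⟨cx, hcx, ζx, wx, hζx, hcorex⟩ := hx
    obtain ⟨cy, hcy, ζy, wy, hζy, hcorey⟩ := hy
    -- classify the two endpoints
    rcases hcx with hcx | hcx <;> rcases hcy with hcy | hcy
    · -- old / old
      have hxold : ∃ c' ∈ C, ∃ ζ w : Site d, ζ = c' + (2 : ℤ) • w ∧
          ∀ i, -(M : ℤ) ≤ 2 * (x i - (M : ℤ) * ζ i) ∧ 2 * (x i - (M : ℤ) * ζ i) ≤ (M : ℤ) - 1 := ⟨cx, hcx, ζx, wx, hζx, hcorex⟩
      have hyold : ∃ c' ∈ C, ∃ ζ w : Site d, ζ = c' + (2 : ℤ) • w ∧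
          ∀ i, -(M : ℤ) ≤ 2 * ((x + e μ) i - (M : ℤ) * ζ i) ∧ 2 * ((x + e μ) i - (M : ℤ) * ζ i) ≤ (M : ℤ) - 1 := ⟨cy, hcy, ζy, wy, hζy, hcorey⟩
      obtain ⟨hτx, hφtx⟩ := hold x hxold
      obtain ⟨hτy, hφty⟩ := hold (x + e μ) hyold
      have hub := hubond x μ hxold hyold
      by_cases hpos : 0 < φt x ∨ 0 < φt (x + e μ)
      · -- a common block `ζ₀` of parity `c` carries both endpoints in its window
        obtain ⟨ζ₀, hZx, hZy, hwin⟩ : ∃ ζ₀ : Site d, Z x = ζ₀ ∧ Z (x + e μ) = ζ₀ ∧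
            (∀ i, -(M : ℤ) ≤ x i - (M : ℤ) * ζ₀ i ∧ x i - (M : ℤ) * ζ₀ i < (M : ℤ)) := by
          rcases hpos with hp | hp
          · have hΦ : 0 < φ (Z x) x := by rw [hφtx] at hp; exact hp
            obtain ⟨w₀, hw₀⟩ := hZpar x
            have hwin := window_of_support hM (hφsupp _ _ hΦ) μ
            exact ⟨Z x, rfl, hZuniq _ _ w₀ hw₀ hwin.2.1, hwin.1⟩
          · have hΦ : 0 < φ (Z (x + e μ)) (x + e μ) := by rw [hφty] at hp; exact hp
            obtain ⟨w₀, hw₀⟩ := hZpar (x + e μ)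
            have hwin := window_of_support hM (hφsupp _ _ hΦ) μ
            have hwin3 := hwin.2.2
            simp only [add_sub_cancel_right] at hwin3
            exact ⟨Z (x + e μ), hZuniq _ _ w₀ hw₀ hwin3, rfl, hwin3⟩
        have herrv := herr_v x μ ζ₀ hZx hZy (cube_of_window hwin)
        have hfine := glue_err_fine (Us := Us) (U' := U') hUs hU' hφt01 hw0 hw1 hwm huU hvU x μ (hτx.trans hτs) (hτy.trans hτs)
        have hlip : |φt x - φt (x + e μ)| ≤ 4 / (M : ℝ) := by
          rw [hφtx, hφty]; show |φ (Z x) x - φ (Z (x + e μ)) (x + e μ)| ≤ _; rw [hZx, hZy]; exact hφlip ζ₀ x μ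
        have h1 : 6 * (1 - φt x) * (‖(((Us x μ)⁻¹ * gaugeAct u U' x μ : 𝔸ˣ) : 𝔸) - 1‖ + ‖(((Us x μ)⁻¹ * gaugeAct v U' x μ : 𝔸ˣ) : 𝔸) - 1‖)
            ≤ 6 * (ηs + ηch) := by
          have ha : 0 ≤ 1 - φt x := by linarith [(hφt01 x).2]
          have hb : 1 - φt x ≤ 1 := by linarith [(hφt01 x).1]
          have hs : ‖(((Us x μ)⁻¹ * gaugeAct u U' x μ : 𝔸ˣ) : 𝔸) - 1‖ + ‖(((Us x μ)⁻¹ * gaugeAct v U' x μ : 𝔸ˣ) : 𝔸) - 1‖ ≤ ηs + ηch := by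
            linarith
          have hs0 : 0 ≤ ‖(((Us x μ)⁻¹ * gaugeAct u U' x μ : 𝔸ˣ) : 𝔸) - 1‖ + ‖(((Us x μ)⁻¹ * gaugeAct v U' x μ : 𝔸ˣ) : 𝔸) - 1‖ := by positivity
          nlinarith
        have h2 : 4 * |φt x - φt (x + e μ)| * ‖((v (x + e μ) : 𝔸ˣ) : 𝔸) - ((u (x + e μ) : 𝔸ˣ) : 𝔸)‖ ≤ 16 * τs / (M : ℝ) := by
          rw [← h16]
          have := abs_nonneg (φt x - φt (x + e μ))
          have h4M : 0 ≤ 4 / (M : ℝ) := by positivity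
          nlinarith [norm_nonneg (((v (x + e μ) : 𝔸ˣ) : 𝔸) - ((u (x + e μ) : 𝔸ˣ) : 𝔸))]
        linarith
      · -- neither endpoint moves
        push Not at hpos
        have hx0 : φt x ≤ 0 := hpos.1
        have hy0 : φt (x + e μ) ≤ 0 := hpos.2
        have : gaugeAct w U' x μ = gaugeAct u U' x μ := hcongr w u x μ (hw0 x hx0) (hw0 _ hy0)
        rw [this]
        have : 0 ≤ 16 * τs / (M : ℝ) := by positivity
        linarith
    · -- old / new: `x` old-covered, `y = x + e_μ` in the new core `ζy`
      have hcyc : cy = c := hcy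
      rw [hcyc] at hζy
      have hxold : ∃ c' ∈ C, ∃ ζ w : Site d, ζ = c' + (2 : ℤ) • w ∧
          ∀ i, -(M : ℤ) ≤ 2 * (x i - (M : ℤ) * ζ i) ∧ 2 * (x i - (M : ℤ) * ζ i) ≤ (M : ℤ) - 1 := ⟨cx, hcx, ζx, wx, hζx, hcorex⟩
      obtain ⟨hτx, hφtx⟩ := hold x hxold
      obtain ⟨hZy, -, hφty, -⟩ := hnew (x + e μ) ζy wy hζy hcorey
      have hwinx : ∀ i, -(M : ℤ) ≤ x i - (M : ℤ) * ζy i ∧ x i - (M : ℤ) * ζy i < (M : ℤ) := by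
        have h := (window_of_core hM hcorey μ).2.2; simp only [add_sub_cancel_right] at h; exact h
      have hZx : Z x = ζy := hZuniq x ζy wy hζy hwinx
      have herrv := herr_v x μ ζy hZx hZy (cube_of_window hwinx)
      have hcrude := glue_err_crude (Us := Us) (U' := U') hUs hU' hφt01 hw0 hw1 hwm huU hvU x μ (fun _ => hτx.trans hτs)
        (fun h => absurd h (by rw [hφty]; norm_num))
      rw [hφty, sub_self, mul_zero, zero_mul, add_zero] at hcrude
      have hgap : 1 - φt x ≤ 4 / (M : ℝ) := by
        rw [hφtx]; show 1 - φ (Z x) x ≤ _; rw [hZx]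
        have h := hφlip ζy x μ
        have h1 : φ ζy (x + e μ) = 1 := hφcore ζy (x + e μ) hcorey
        rw [h1] at h
        linarith [le_abs_self (φ ζy x - 1), neg_abs_le (φ ζy x - 1)]
      have h3 : 4 * (1 - φt x) * ‖((v x : 𝔸ˣ) : 𝔸) - ((u x : 𝔸ˣ) : 𝔸)‖ ≤ 16 * τs / (M : ℝ) := by
        rw [← h16]
        have ha : 0 ≤ 1 - φt x := by linarith [(hφt01 x).2]
        nlinarith [norm_nonneg (((v x : 𝔸ˣ) : 𝔸) - ((u x : 𝔸ˣ) : 𝔸))]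
      linarith
    · -- new / old: `x` in the new core `ζx`, `y` old-covered
      have hcxc : cx = c := hcx
      rw [hcxc] at hζx
      have hyold : ∃ c' ∈ C, ∃ ζ w : Site d, ζ = c' + (2 : ℤ) • w ∧
          ∀ i, -(M : ℤ) ≤ 2 * ((x + e μ) i - (M : ℤ) * ζ i) ∧ 2 * ((x + e μ) i - (M : ℤ) * ζ i) ≤ (M : ℤ) - 1 := ⟨cy, hcy, ζy, wy, hζy, hcorey⟩
      obtain ⟨hτy, hφty⟩ := hold (x + e μ) hyold
      obtain ⟨hZx, -, hφtx, -⟩ := hnew x ζx wx hζx hcorex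
      have hwiny : ∀ i, -(M : ℤ) ≤ (x + e μ) i - (M : ℤ) * ζx i ∧ (x + e μ) i - (M : ℤ) * ζx i < (M : ℤ) := (window_of_core hM hcorex μ).2.1
      have hZy : Z (x + e μ) = ζx := hZuniq (x + e μ) ζx wx hζx hwiny
      have herrv := herr_v x μ ζx hZx hZy (cube_of_window (window_of_core_self hcorex))
      have hcrude := glue_err_crude (Us := Us) (U' := U') hUs hU' hφt01 hw0 hw1 hwm huU hvU x μ (fun h => absurd h (by rw [hφtx]; norm_num))
        (fun _ => hτy.trans hτs)
      rw [hφtx, sub_self, mul_zero, zero_mul, add_zero] at hcrude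
      have hgap : 1 - φt (x + e μ) ≤ 4 / (M : ℝ) := by
        rw [hφty]; show 1 - φ (Z (x + e μ)) (x + e μ) ≤ _; rw [hZy]
        have h := hφlip ζx x μ
        have h1 : φ ζx x = 1 := hφcore ζx x hcorex
        rw [h1] at h
        linarith [le_abs_self (1 - φ ζx (x + e μ)), neg_abs_le (1 - φ ζx (x + e μ))]
      have h3 : 4 * (1 - φt (x + e μ)) * ‖((v (x + e μ) : 𝔸ˣ) : 𝔸) - ((u (x + e μ) : 𝔸ˣ) : 𝔸)‖ ≤ 16 * τs / (M : ℝ) := by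
        rw [← h16]
        have ha : 0 ≤ 1 - φt (x + e μ) := by linarith [(hφt01 (x + e μ)).2]
        nlinarith [norm_nonneg (((v (x + e μ) : 𝔸ˣ) : 𝔸) - ((u (x + e μ) : 𝔸ˣ) : 𝔸))]
      linarith
    · -- new / new: the same block
      have hcxc : cx = c := hcx
      have hcyc : cy = c := hcy
      rw [hcxc] at hζx; rw [hcyc] at hζy
      have hζeq : ζy = ζx := core_step_parity hM1 hζx hζy hcorex hcorey
      rw [hζeq] at hcorey
      obtain ⟨hZx, -, -, hwx⟩ := hnew x ζx wx hζx hcorex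
      obtain ⟨hZy, -, -, hwy⟩ := hnew (x + e μ) ζx wx hζx hcorey
      have : gaugeAct w U' x μ = gaugeAct (g ζx) U' x μ := hcongr w (g ζx) x μ hwx hwy
      rw [this]
      exact (herr ζx x μ (cube_of_window (window_of_core_self hcorex))).trans hbig

end

end Summit.QuantumFields.BalabanUV.T4Continuum.NE7PairColourStep
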